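import Summits.Ventures.CertifiedArithmetic.LowPrec.OptTreeChain

/-!
# Opt / CM-T — Theorem T3(a), chain 2, for EVERY tree shape: the double-cherry / three-leaf chain `κ/(256+κ)`

HONEST FRAMING: certified error envelopes and provably optimal rounding/accumulation schemes for
low-precision formats under stated cost models; every table by two implementations; no hardware or
vendor claims.

Setting as in `OptTreeChain.lean` (OPTIMA.md §T, Theorem T3; E2M1 × E2M1 products summed by a fixed
binary tree in bfloat16, round to nearest even). CHAIN 2 of T3(a): `64` is reached EXACTLY from three
leaves (`(36 + 24) + 4`), or a node with two internal children computes `(36 + 24) + (4 + ¼) = 64¼ ↦ 64`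
(a midpoint; the even neighbour `64` is kept, loss `¼`); afterwards every higher node on the path adds one
`¼` from its sibling subtree and computes `fl(64 + ¼) = 64` (loss `¼` each). With
`κ(t) = max(1 + depth of a node both of whose children are internal, depth of a node with ≥ 3 leaves, 0)`
this gives `ŝ = 64`, `s = Σ|tᵢ| = 64 + κ/4`, i.e. `|ŝ - s| / Σ|tᵢ| = κ/(256+κ)` — the chain-2 half of the
three-chain lower bound `W(shape) ≥ LB3(shape)` of OPTIMA.md T3(a) (chain 1, `(h-1)/(287+h)`, is
`t3_chain1_ratio`; chain 3 and all upper bounds are certificate-only, C12).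

* `numLeaves`, `kappa`: leaf count and the invariant `κ` (a priority-ordered recursion equal to the max above);
* `spike2 a b t`: `a` on the left-most leaf of the left child, `b` on the left-most leaf of the right child;
* `chain2 t`: the witness relabelling; `spike_zero_chain2`: it has the shape of `t`;
* `chain2_spec`: `ŝ = 64`, `s = Σ|tᵢ| = 64 + κ/4` for every tree with `≥ 3` leaves;
* `t3_chain2_ratio`: `|ŝ - s| / Σ|tᵢ| = κ/(256+κ)` with all leaves in the product alphabet `piE2M1`.
-/

namespace Summit.Ventures.CertifiedArithmetic.LowPrec.Opt

open Literature.ComputerArithmetic.JeannerodRump2018 (SumTree)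
open Literature.ComputerArithmetic.FloatingPoint (Format)
open Literature.ComputerArithmetic.FloatingPoint.MiniFloat (flα absLeafSum treeHeight piE2M1)

/-- Number of leaves of a tree. [folklore] -/
def numLeaves : SumTree → ℕ
  | .leaf _ => 1
  | .node l r => numLeaves l + numLeaves r

/-- The chain-2 invariant `κ`: priority-ordered form of
`max(1 + depth of a node with two internal children, depth of a node with ≥ 3 leaves, 0)`. [new] -/
def kappa : SumTree → ℕ
  | .leaf _ => 0
  | .node l r =>
      if 3 ≤ numLeaves l ∧ (numLeaves r < 3 ∨ kappa r ≤ kappa l) then kappa l + 1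
      else if 3 ≤ numLeaves r then kappa r + 1
      else if 2 ≤ numLeaves l ∧ 2 ≤ numLeaves r then 1 else 0

/-- `a` on the left-most leaf of the left child, `b` on the left-most leaf of the right child, `0`
elsewhere (used on internal trees only). [folklore] -/
def spike2 (a b : ℚ) : SumTree → SumTree
  | .leaf _ => .leaf (a + b)
  | .node l r => .node (spike a l) (spike b r)

/-- The chain-2 witness relabelling of `t`: descend towards a node realising `κ`; at the bottom either a
node with two internal children gets `(36,24 | 4,¼)` or a three-leaf node gets `(36,24 | 4)`; the sibling
subtree of every higher path node carries one `¼`. [new] -/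
def chain2 : SumTree → SumTree
  | .leaf _ => .leaf 0
  | .node l r =>
      if 3 ≤ numLeaves l ∧ (numLeaves r < 3 ∨ kappa r ≤ kappa l) then .node (chain2 l) (spike (1 / 4) r)
      else if 3 ≤ numLeaves r then .node (spike (1 / 4) l) (chain2 r)
      else if 2 ≤ numLeaves l ∧ 2 ≤ numLeaves r then .node (spike2 36 24 l) (spike2 4 (1 / 4) r)
      else if 2 ≤ numLeaves l then .node (spike2 36 24 l) (spike 4 r)
      else .node (spike 4 l) (spike2 36 24 r)

/-! ### bfloat16 facts (executable model, kernel-checked) -/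

/-- `fl(36) = 36`. [folklore] -/
theorem flBF_36 : flα Format.BFloat16 36 = 36 := by decide +kernel
/-- `fl(24) = 24`. [folklore] -/
theorem flBF_24 : flα Format.BFloat16 24 = 24 := by decide +kernel
/-- `fl(4) = 4`. [folklore] -/
theorem flBF_4 : flα Format.BFloat16 4 = 4 := by decide +kernel
/-- `36 + 24 = 60` is exact. [folklore] -/
theorem flBF_36_24 : flα Format.BFloat16 (36 + 24) = 60 := by decide +kernel
/-- `4 + ¼` is exact. [folklore] -/
theorem flBF_4_quarter : flα Format.BFloat16 (4 + 1 / 4) = 4 + 1 / 4 := by decide +kernel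
/-- `60 + 4 = 64` is exact. [folklore] -/
theorem flBF_60_4 : flα Format.BFloat16 (60 + 4) = 64 := by decide +kernel
/-- `4 + 60 = 64` is exact. [folklore] -/
theorem flBF_4_60 : flα Format.BFloat16 (4 + 60) = 64 := by decide +kernel
/-- THE FIRST TIE: `60 + 4¼ = 64¼` is the midpoint of the bfloat16 neighbours `64` and `64.5`;
nearest-even keeps `64`. [folklore] -/
theorem flBF_60_4_quarter : flα Format.BFloat16 (60 + (4 + 1 / 4)) = 64 := by decide +kernel
/-- THE PATH TIE: `fl(64 + ¼) = 64`. [folklore] -/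
theorem flBF_64_quarter : flα Format.BFloat16 (64 + 1 / 4) = 64 := by decide +kernel
/-- `fl(¼ + 64) = 64`. [folklore] -/
theorem flBF_quarter_64 : flα Format.BFloat16 (1 / 4 + 64) = 64 := by decide +kernel

/-! ### Leaf counting -/

/-- Every tree has a leaf. [folklore] -/
theorem numLeaves_pos : ∀ t, 1 ≤ numLeaves t
  | .leaf _ => le_rfl
  | .node l _ => le_trans (numLeaves_pos l) (Nat.le_add_right _ _)

/-- `numLeaves` is the length of the leaf list. [folklore] -/
theorem numLeaves_eq_length : ∀ t, numLeaves t = (SumTree.leaves t).length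
  | .leaf _ => rfl
  | .node l r => by simp only [numLeaves, SumTree.leaves, List.length_append, numLeaves_eq_length]

/-- A tree with at least two leaves is a node. [folklore] -/
theorem exists_node_of_two_le : ∀ t, 2 ≤ numLeaves t → ∃ l r, t = .node l r
  | .leaf _, h => by simp [numLeaves] at h
  | .node l r, _ => ⟨l, r, rfl⟩

/-- `spike` preserves the leaf count. [folklore] -/
theorem numLeaves_spike (c : ℚ) : ∀ t, numLeaves (spike c t) = numLeaves t
  | .leaf _ => rfl
  | .node l r => by simp only [spike, numLeaves, numLeaves_spike]

/-! ### The two-spike relabelling (on a node) -/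

/-- Shape. [folklore] -/
theorem spike_zero_spike2 (a b : ℚ) (l r : SumTree) : spike 0 (spike2 a b (.node l r)) = spike 0 (.node l r) := by
  simp only [spike2, spike, spike_zero_spike]

/-- Evaluation: `fl(a + b)` when `a`, `b` are representable. [folklore] -/
theorem eval_spike2 (a b : ℚ) (ha : flα Format.BFloat16 a = a) (hb : flα Format.BFloat16 b = b) (l r : SumTree) :
    SumTree.eval (flα Format.BFloat16) (spike2 a b (.node l r)) = flα Format.BFloat16 (a + b) := by
  simp only [spike2, SumTree.eval, eval_spike a ha, eval_spike b hb]

/-- Exact sum `a + b`. [folklore] -/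
theorem exact_spike2 (a b : ℚ) (l r : SumTree) : SumTree.exact (spike2 a b (.node l r)) = a + b := by
  simp only [spike2, SumTree.exact, exact_spike]

/-- Leaf mass `|a| + |b|`. [folklore] -/
theorem absLeafSum_spike2 (a b : ℚ) (l r : SumTree) : absLeafSum (spike2 a b (.node l r)) = |a| + |b| := by
  simp only [spike2, absLeafSum, absLeafSum_spike]

/-- Leaves are `a`, `b` or `0`. [folklore] -/
theorem leaves_spike2 (a b : ℚ) (l r : SumTree) :
    ∀ x ∈ SumTree.leaves (spike2 a b (.node l r)), x = a ∨ x = b ∨ x = 0 := by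
  intro x hx
  simp only [spike2, SumTree.leaves, List.mem_append] at hx
  rcases hx with hx | hx
  · rcases leaves_spike a l x hx with h | h
    · exact Or.inl h
    · exact Or.inr (Or.inr h)
  · rcases leaves_spike b r x hx with h | h
    · exact Or.inr (Or.inl h)
    · exact Or.inr (Or.inr h)

/-! ### The chain-2 witness -/

/-- `chain2 t` has the shape of `t` (for trees with at least three leaves). [new] -/
theorem spike_zero_chain2 : ∀ t, 3 ≤ numLeaves t → spike 0 (chain2 t) = spike 0 t
  | .leaf _, h => by simp [numLeaves] at h
  | .node l r, h3 => by
      have h3' : 3 ≤ numLeaves l + numLeaves r := h3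
      have hl1 := numLeaves_pos l
      have hr1 := numLeaves_pos r
      unfold chain2
      split_ifs with c1 c2 c3 c4
      · simp only [spike, spike_zero_chain2 l c1.1, spike_zero_spike]
      · simp only [spike, spike_zero_chain2 r c2, spike_zero_spike]
      · obtain ⟨l1, l2, rfl⟩ := exists_node_of_two_le l c3.1
        obtain ⟨r1, r2, rfl⟩ := exists_node_of_two_le r c3.2
        simp only [spike, spike2, spike_zero_spike]
      · obtain ⟨l1, l2, rfl⟩ := exists_node_of_two_le l c4
        simp only [spike, spike2, spike_zero_spike]
      · obtain ⟨r1, r2, rfl⟩ := exists_node_of_two_le r (by omega)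
        simp only [spike, spike2, spike_zero_spike]

/-- Every leaf of the witness is `36`, `24`, `4`, `¼` or `0`. [new] -/
theorem chain2_leaves : ∀ t, 3 ≤ numLeaves t →
    ∀ x ∈ SumTree.leaves (chain2 t), x = 36 ∨ x = 24 ∨ x = 4 ∨ x = 1 / 4 ∨ x = 0
  | .leaf _, h => by simp [numLeaves] at h
  | .node l r, h3 => by
      have h3' : 3 ≤ numLeaves l + numLeaves r := h3
      have hl1 := numLeaves_pos l
      have hr1 := numLeaves_pos r
      intro x hx
      unfold chain2 at hx
      split_ifs at hx with c1 c2 c3 c4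
      · simp only [SumTree.leaves, List.mem_append] at hx
        rcases hx with hx | hx
        · exact chain2_leaves l c1.1 x hx
        · rcases leaves_spike (1 / 4) r x hx with h | h
          · exact Or.inr (Or.inr (Or.inr (Or.inl h)))
          · exact Or.inr (Or.inr (Or.inr (Or.inr h)))
      · simp only [SumTree.leaves, List.mem_append] at hx
        rcases hx with hx | hx
        · rcases leaves_spike (1 / 4) l x hx with h | h
          · exact Or.inr (Or.inr (Or.inr (Or.inl h)))
          · exact Or.inr (Or.inr (Or.inr (Or.inr h)))
        · exact chain2_leaves r c2 x hx
      · obtain ⟨l1, l2, rfl⟩ := exists_node_of_two_le l c3.1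
        obtain ⟨r1, r2, rfl⟩ := exists_node_of_two_le r c3.2
        simp only [SumTree.leaves, List.mem_append] at hx
        rcases hx with hx | hx
        · rcases leaves_spike2 36 24 l1 l2 x (by simpa only [SumTree.leaves] using hx) with h | h | h
          · exact Or.inl h
          · exact Or.inr (Or.inl h)
          · exact Or.inr (Or.inr (Or.inr (Or.inr h)))
        · rcases leaves_spike2 4 (1 / 4) r1 r2 x (by simpa only [SumTree.leaves] using hx) with h | h | h
          · exact Or.inr (Or.inr (Or.inl h))
          · exact Or.inr (Or.inr (Or.inr (Or.inl h)))
          · exact Or.inr (Or.inr (Or.inr (Or.inr h)))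
      · obtain ⟨l1, l2, rfl⟩ := exists_node_of_two_le l c4
        simp only [SumTree.leaves, List.mem_append] at hx
        rcases hx with hx | hx
        · rcases leaves_spike2 36 24 l1 l2 x (by simpa only [SumTree.leaves] using hx) with h | h | h
          · exact Or.inl h
          · exact Or.inr (Or.inl h)
          · exact Or.inr (Or.inr (Or.inr (Or.inr h)))
        · rcases leaves_spike 4 r x hx with h | h
          · exact Or.inr (Or.inr (Or.inl h))
          · exact Or.inr (Or.inr (Or.inr (Or.inr h)))
      · obtain ⟨r1, r2, rfl⟩ := exists_node_of_two_le r (by omega)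
        simp only [SumTree.leaves, List.mem_append] at hx
        rcases hx with hx | hx
        · rcases leaves_spike 4 l x hx with h | h
          · exact Or.inr (Or.inr (Or.inl h))
          · exact Or.inr (Or.inr (Or.inr (Or.inr h)))
        · rcases leaves_spike2 36 24 r1 r2 x (by simpa only [SumTree.leaves] using hx) with h | h | h
          · exact Or.inl h
          · exact Or.inr (Or.inl h)
          · exact Or.inr (Or.inr (Or.inr (Or.inr h)))

/-- Every leaf of the witness is an `E2M1 × E2M1` product (`36 = 6·6`, `24 = 6·4`, `4 = 4·1`,
`¼ = ½·½`, `0`). [new] -/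
theorem chain2_leaves_mem (t : SumTree) (h3 : 3 ≤ numLeaves t) :
    ∀ x ∈ SumTree.leaves (chain2 t), x ∈ piE2M1 := by
  intro x hx
  rcases chain2_leaves t h3 x hx with rfl | rfl | rfl | rfl | rfl <;> norm_num [piE2M1]

/-- The defining equation of `κ` at a node. [new] -/
theorem kappa_node (l r : SumTree) : kappa (.node l r) =
    (if 3 ≤ numLeaves l ∧ (numLeaves r < 3 ∨ kappa r ≤ kappa l) then kappa l + 1
      else if 3 ≤ numLeaves r then kappa r + 1
      else if 2 ≤ numLeaves l ∧ 2 ≤ numLeaves r then 1 else 0) := by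
  rw [kappa]

/-- THE INDUCTION: for a tree with `≥ 3` leaves the witness evaluates to `64`, with exact sum and leaf
mass `64 + κ/4`. [new] -/
theorem chain2_spec : ∀ t, 3 ≤ numLeaves t →
    SumTree.eval (flα Format.BFloat16) (chain2 t) = 64 ∧
    SumTree.exact (chain2 t) = 64 + (kappa t : ℚ) / 4 ∧
    absLeafSum (chain2 t) = 64 + (kappa t : ℚ) / 4
  | .leaf _, h => by simp [numLeaves] at h
  | .node l r, h3 => by
      have h3' : 3 ≤ numLeaves l + numLeaves r := h3
      have hl1 := numLeaves_pos l
      have hr1 := numLeaves_pos r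
      unfold chain2
      split_ifs with c1 c2 c3 c4
      · -- descend left: `fl(64 + ¼) = 64`
        have hk : kappa (.node l r) = kappa l + 1 := by rw [kappa_node, if_pos c1]
        obtain ⟨he, hx, ha⟩ := chain2_spec l c1.1
        refine ⟨?_, ?_, ?_⟩
        · simp only [SumTree.eval, he, eval_spike (1 / 4) flBF_quarter r, flBF_64_quarter]
        · simp only [SumTree.exact, hx, exact_spike, hk]; push_cast; ring
        · simp only [absLeafSum, ha, absLeafSum_spike, hk]; push_cast
          rw [abs_of_pos (by norm_num : (0 : ℚ) < 1 / 4)]; ring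
      · -- descend right
        have hk : kappa (.node l r) = kappa r + 1 := by rw [kappa_node, if_neg c1, if_pos c2]
        obtain ⟨he, hx, ha⟩ := chain2_spec r c2
        refine ⟨?_, ?_, ?_⟩
        · simp only [SumTree.eval, he, eval_spike (1 / 4) flBF_quarter l, flBF_quarter_64]
        · simp only [SumTree.exact, hx, exact_spike, hk]; push_cast; ring
        · simp only [absLeafSum, ha, absLeafSum_spike, hk]; push_cast
          rw [abs_of_pos (by norm_num : (0 : ℚ) < 1 / 4)]; ring
      · -- bottom, two internal children: `(36 + 24) + (4 + ¼) = 64¼ ↦ 64`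
        have hk : kappa (.node l r) = 1 := by rw [kappa_node, if_neg c1, if_neg c2, if_pos c3]
        obtain ⟨l1, l2, rfl⟩ := exists_node_of_two_le l c3.1
        obtain ⟨r1, r2, rfl⟩ := exists_node_of_two_le r c3.2
        refine ⟨?_, ?_, ?_⟩
        · simp only [SumTree.eval, eval_spike2 36 24 flBF_36 flBF_24, eval_spike2 4 (1 / 4) flBF_4 flBF_quarter,
            flBF_36_24, flBF_4_quarter, flBF_60_4_quarter]
        · rw [hk]; simp only [SumTree.exact, exact_spike2]; norm_num
        · rw [hk]; simp only [absLeafSum, absLeafSum_spike2]; norm_num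
      · -- bottom, a cherry and a third leaf: `(36 + 24) + 4 = 64` exactly
        have hk : kappa (.node l r) = 0 := by rw [kappa_node, if_neg c1, if_neg c2, if_neg c3]
        obtain ⟨l1, l2, rfl⟩ := exists_node_of_two_le l c4
        refine ⟨?_, ?_, ?_⟩
        · simp only [SumTree.eval, eval_spike2 36 24 flBF_36 flBF_24, eval_spike 4 flBF_4 r, flBF_36_24, flBF_60_4]
        · rw [hk]; simp only [SumTree.exact, exact_spike2, exact_spike]; norm_num
        · rw [hk]; simp only [absLeafSum, absLeafSum_spike2, absLeafSum_spike]; norm_num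
      · -- bottom, mirrored: `4 + (36 + 24) = 64` exactly
        have hk : kappa (.node l r) = 0 := by rw [kappa_node, if_neg c1, if_neg c2, if_neg c3]
        obtain ⟨r1, r2, rfl⟩ := exists_node_of_two_le r (by omega)
        refine ⟨?_, ?_, ?_⟩
        · simp only [SumTree.eval, eval_spike2 36 24 flBF_36 flBF_24, eval_spike 4 flBF_4 l, flBF_36_24, flBF_4_60]
        · rw [hk]; simp only [SumTree.exact, exact_spike2, exact_spike]; norm_num
        · rw [hk]; simp only [absLeafSum, absLeafSum_spike2, absLeafSum_spike]; norm_num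

/-- OPTIMA.md Theorem T3(a), chain 2, ALL shapes: every reduction tree `t` with at least three leaves
admits a relabelling of the same shape by `E2M1 × E2M1` products whose bfloat16 (RNE) evaluation has
relative error EXACTLY `κ/(256+κ)`; hence `W(shape) ≥ κ/(256+κ)`. [new] -/
theorem t3_chain2_ratio (t : SumTree) (h3 : 3 ≤ numLeaves t) :
    spike 0 (chain2 t) = spike 0 t ∧ (∀ x ∈ SumTree.leaves (chain2 t), x ∈ piE2M1) ∧
    |SumTree.eval (flα Format.BFloat16) (chain2 t) - SumTree.exact (chain2 t)| / absLeafSum (chain2 t)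
      = (kappa t : ℚ) / (256 + kappa t) := by
  refine ⟨spike_zero_chain2 t h3, chain2_leaves_mem t h3, ?_⟩
  obtain ⟨he, hx, ha⟩ := chain2_spec t h3
  have h0 : (0 : ℚ) ≤ kappa t := by exact_mod_cast Nat.zero_le _
  rw [he, hx, ha, show (64 : ℚ) - (64 + (kappa t : ℚ) / 4) = -((kappa t : ℚ) / 4) by ring,
    abs_neg, abs_of_nonneg (by linarith)]
  have hne : (64 : ℚ) + (kappa t : ℚ) / 4 ≠ 0 := ne_of_gt (by linarith)
  have hne' : (256 : ℚ) + (kappa t : ℚ) ≠ 0 := ne_of_gt (by linarith)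
  rw [div_eq_div_iff hne hne']
  ring

/-- The same statement over the leaf-list length. [new] -/
theorem t3_chain2_ratio' (t : SumTree) (h3 : 3 ≤ (SumTree.leaves t).length) :
    spike 0 (chain2 t) = spike 0 t ∧ (∀ x ∈ SumTree.leaves (chain2 t), x ∈ piE2M1) ∧
    |SumTree.eval (flα Format.BFloat16) (chain2 t) - SumTree.exact (chain2 t)| / absLeafSum (chain2 t)
      = (kappa t : ℚ) / (256 + kappa t) :=
  t3_chain2_ratio t (by rwa [numLeaves_eq_length])

/-- Instance (sanity, kernel-checked): the `(4,2)` shape on six leaves has `κ = 2` (double cherry at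
depth 1), so `W ≥ 2/258 = 1/129` — its certified exact value (C12), which SEPARATES it from the `(3,3)`
shape of equal height and external path length (`W = 1/145`). [new] -/
example : kappa (.node (.node (.node (.leaf 0) (.leaf 0)) (.node (.leaf 0) (.leaf 0))) (.node (.leaf 0) (.leaf 0))) = 2 := by
  decide

/-- … and the witness is `(((36+24)+(4+¼))+(¼+0))`. [new] -/
example : chain2 (.node (.node (.node (.leaf 0) (.leaf 0)) (.node (.leaf 0) (.leaf 0))) (.node (.leaf 0) (.leaf 0))) =
    .node (.node (.node (.leaf 36) (.leaf 24)) (.node (.leaf 4) (.leaf (1 / 4)))) (.node (.leaf (1 / 4)) (.leaf 0)) := by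
  rfl

end Summit.Ventures.CertifiedArithmetic.LowPrec.Opt
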